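import Summits.QuantumFields.YangMills.Theorems.CovariantDischargeMatchedChargeKernelBounds
import HarnessLib

/-!
# Line «sandwich_discharge» on crux `HistoryTailL` (stmt-QuantumFields-19936), stub `stub_sandwichSweepGapCapped` (S′), brick B5 on `ℤ³` —
# «THE DYADIC `ℓ¹` MASS OF A MATCHED CHARGE'S FIELD»: near sum once, then one dyadic shell at a time (sequel to ✓`CovariantDischargeMatchedChargeKernelBounds`)

Cell `ym3-torus` (YM ladder rung R3 = continuum SU(2) Yang–Mills on the three-torus — a RUNG, NOT the Clay problem); TWIN-WIDTH helper seat
`ym-ust-19936-w8` gen 8; `--supports stmt-QuantumFields-19936` (helper; LOCATE-B5-Z3-COMMUTATOR-w8g8 §4 ∕ ADDENDUM cb2dbbcc §B «dyadic refinement»).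
THEOREMS ONLY (0 `def`, default heartbeats), `Zd 3`∕`box` letters of lit ✓`B4Eq19LatticeOperators`.
WHY.  ✓p713769 gives the NEAR `ℓ¹` mass `Σ_{box p N}|K∗ω| ≤ (|K 0| + 26C₁(N+ℓ))·Σ|ω|` (crude, linear in `N`) and the DYADIC-SHELL mass
`Σ_{box p (2N) ∖ box p (N−1)}|K∗ω| ≤ 1000·C₂·M₁` (radius-free, from the dipole far field of a mean-zero charge).  Chaining them gives the sharp
`ℓ¹` mass of the sweep amplitude up to radius `2^k·N₀`: linear in the NUMBER OF SHELLS `k`, not in the radius — the `L^{2j+h}·j log L` form that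
the frame-defect row (r2) of ARCH-S′ §6 may prefer to the crude `C₁L^{2j}R`:
* `sum_box_le_sum_box_of_le`, `sum_box_two_mul_le` — monotonicity and the one-step split `Σ_{box p 2N} ≤ Σ_{box p N} + Σ_{shell N}`;
* ★★ `sum_box_dyadic_abs_sum_mul_le` — `Σ_{box p (2^k N₀)}|Σ_y K(x−y)ω y| ≤ (|K 0| + 26C₁(N₀+ℓ))·Σ|ω| + k·1000·C₂·M₁` for `N₀ ≥ 2ℓ+2`.
HONEST SCOPE.  Bookkeeping; nothing of B5, the stub, `HistoryTailL` or any summit statement is proved; YM₃ on T³ is rung R3, not Clay. [folklore]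
-/

noncomputable section

open scoped BigOperators
open Finset

namespace Summit.QuantumFields.YangMills.Theorems.CovariantDischargeMatchedChargeDyadicMass

open Literature.MathematicalPhysics.QuantumFieldTheory.Balaban1983to89.B4Eq19LatticeOperators
open Summit.QuantumFields.YangMills.Theorems.CovariantDischargeMatchedChargeKernelBounds (sum_box_abs_sum_mul_le shell_sum_far_field_le)

/-! ## The dyadic `ℓ¹` mass of `K ∗ ω` (near sum + `k` dyadic shells) -/

/-- Box sums of a nonnegative summand are monotone in the radius. [folklore] -/
theorem sum_box_le_sum_box_of_le {f : Zd 3 → ℝ} (hf : ∀ x, 0 ≤ f x) (p : Zd 3) {r r' : ℤ} (h : r ≤ r') :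
    ∑ x ∈ box p r, f x ≤ ∑ x ∈ box p r', f x :=
  Finset.sum_le_sum_of_subset_of_nonneg (box_mono p h) fun x _ _ => hf x

/-- One dyadic step: `Σ_{box p (2N)} ≤ Σ_{box p N} + Σ_{box p (2N) ∖ box p (N−1)}` for a nonnegative summand. [folklore] -/
theorem sum_box_two_mul_le {f : Zd 3 → ℝ} (hf : ∀ x, 0 ≤ f x) (p : Zd 3) (N : ℕ) :
    ∑ x ∈ box p (2 * (N : ℤ)), f x ≤ ∑ x ∈ box p N, f x + ∑ x ∈ box p (2 * N) \ box p ((N : ℤ) - 1), f x := by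
  have hsub : box p ((N : ℤ) - 1) ⊆ box p (2 * (N : ℤ)) := box_mono p (by omega)
  rw [← Finset.sum_sdiff hsub, add_comm]
  exact add_le_add (sum_box_le_sum_box_of_le hf p (by omega)) le_rfl

/-- ★★ **THE DYADIC `ℓ¹` MASS OF `K ∗ ω`** (`d = 3`): with (H1) `|K w| ≤ C₁∕n²` (`‖w‖_∞ ≥ n ≥ 1`), (H2) `|K(w+e_i) − K w| ≤ C₂∕n³` (`‖w‖_∞ ≥ n ≥ 2`), a
mean-zero charge `ω` on `box p ℓ` and a base radius `N₀ ≥ 2ℓ + 2`: for every `k`,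
`Σ_{x ∈ box p (2^k·N₀)} |Σ_y K(x−y)·ω y| ≤ (|K 0| + 26·C₁·(N₀ + ℓ))·Σ_y|ω y| + k·1000·C₂·M₁(ω)` — the near mass once, then `1000·C₂·M₁` per dyadic
shell (so `log₂(R∕N₀)` shells up to radius `R`: the `L^{2j+h}·j log L` form of the sweep amplitude's `ℓ¹` mass, LOCATE-B5-Z3 §4). [folklore] -/
theorem sum_box_dyadic_abs_sum_mul_le (K : Zd 3 → ℝ) {C₁ C₂ : ℝ} (hC₁ : 0 ≤ C₁) (hC₂ : 0 ≤ C₂)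
    (hK1 : ∀ (w : Zd 3) (n : ℕ), 1 ≤ n → w ∉ box 0 ((n : ℤ) - 1) → |K w| ≤ C₁ / (n : ℝ) ^ 2)
    (hK2 : ∀ (w : Zd 3) (n : ℕ), 2 ≤ n → w ∉ box 0 ((n : ℤ) - 1) → ∀ i, |K (w + unitVec i) - K w| ≤ C₂ / (n : ℝ) ^ 3)
    (ω : Zd 3 → ℝ) (p : Zd 3) (ℓ : ℕ) (hsum : ∑ y ∈ box p ℓ, ω y = 0) (N₀ : ℕ) (hN₀ : 2 * ℓ + 2 ≤ N₀) :
    ∀ k : ℕ, ∑ x ∈ box p ((2 ^ k * N₀ : ℕ) : ℤ), |∑ y ∈ box p ℓ, K (x - y) * ω y| ≤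
      (|K 0| + 26 * C₁ * ((N₀ : ℝ) + ℓ)) * ∑ y ∈ box p ℓ, |ω y| +
        k * (1000 * C₂ * ∑ y ∈ box p ℓ, (∑ i, |((y i - p i : ℤ) : ℝ)|) * |ω y|) := by
  intro k
  induction k with
  | zero =>
      simp only [pow_zero, one_mul, Nat.cast_zero, zero_mul, add_zero]
      exact sum_box_abs_sum_mul_le K hC₁ hK1 ω p ℓ N₀
  | succ k ih =>
      have hf : ∀ x : Zd 3, 0 ≤ |∑ y ∈ box p ℓ, K (x - y) * ω y| := fun x => abs_nonneg _
      have hNk : 2 * ℓ + 2 ≤ 2 ^ k * N₀ := hN₀.trans (Nat.le_mul_of_pos_left N₀ (by positivity))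
      have hstep := sum_box_two_mul_le hf p (2 ^ k * N₀)
      have hshell := shell_sum_far_field_le K hC₂ hK2 ω p ℓ hsum (2 ^ k * N₀) hNk
      rw [show (((2 ^ (k + 1) * N₀ : ℕ)) : ℤ) = 2 * (((2 ^ k * N₀ : ℕ)) : ℤ) by push_cast; ring]
      refine hstep.trans ?_
      push_cast at ih hshell ⊢
      have : ∑ x ∈ box p (2 * (2 ^ k * (N₀ : ℤ))) \ box p (2 ^ k * (N₀ : ℤ) - 1), |∑ y ∈ box p ℓ, K (x - y) * ω y| ≤
          1000 * C₂ * ∑ y ∈ box p ℓ, (∑ i, |((y i - p i : ℤ) : ℝ)|) * |ω y| := by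
        convert hshell using 3; push_cast; ring
      linarith

end Summit.QuantumFields.YangMills.Theorems.CovariantDischargeMatchedChargeDyadicMass

end
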